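import Summits.AnomalousDissipation.AnomalousDissipation.Theorems.SawtoothPulseCascadeApproxLipAssembly
import Summits.AnomalousDissipation.AnomalousDissipation.Theorems.SawtoothPulseCascadeApproxEnvelopeBox

/-!
# The continuous Lipschitz envelope of the forced linearised response on the box
# (S2 of the line `linear-response-lip`)
(route `AnomalousDissipation/SawtoothPulseCascade`; helper for the crux ApproxSol58 = stmt-AnomalousDissipation-19688)

**Theorem (`responseLipEnvelope`).**  For `(γ, ρN) ∈ [5,8] × {2,…,7}`, assuming the per-phase LIPSCHITZ cap
`K2LipschitzGrowthClassical ⟨γ,1/4,2,1,ρN⟩ G` (Literature `SawtoothCascadeK2Lipschitz.lean`) with some factor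
`0 ≤ G < (γ² − 3)²`: with `M₁ = max G (4ρN²) < (γ² − 3)²` and `K = 64 (48π√(2π) + 12√π) γ`, for every lag `A` there is
`ν₀ > 0` such that for all `ν ∈ (0, ν₀]`, every window `[0, T']`, `horizon (γ²−3) ν A < T' < 1`, and every classical
solution `(L, q)` of the heat-lag-forced linearised equations on `[0, T']` from zero there is a CONTINUOUS `Λ` on
`[0, horizon]` with `‖DL(t)(x)‖ ≤ Λ(t)` everywhere and `Λ(t) ≤ K ν (j+1) M₁^{j+1}` for `t ≤ horizon` in phase `j`.

This is S2 `stub_responseLipEnvelope` of the lead's reshaped skeleton `linear-response-lip` (evidence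
`ApproxSol58_linearResponseLip_v21.lean` on the item), with the response hypotheses spelled out and the route-level
Lipschitz conjecture `K2LipschitzCascadeGrowth58` replaced by its instance at the box point (the conjecture itself is
crux-sized and is NOT asserted anywhere in the tree).  Pipeline: slot-wise Duhamel in the Lipschitz norm (`…ApproxLipSlot`)
+ realignment with Lipschitz sizes (`…ApproxRealignLip`) + the Lipschitz cap per piece (`…ApproxLipPieces`) + the budget
`16π²νN_j²tHalf_j ≤ δ_j²` up to the horizon phase (`…ApproxEnvelope58.budget_threshold`) + the continuous sup envelope
`Λ(t) = Σᵢ ‖∂ᵢL(t)‖_∞` (`…ApproxLipTools.exists_lipEnvelope`) + `4ρN² ≤ 196 < 484 ≤ (γ²−3)²`.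
-/

set_option linter.dupNamespace false

noncomputable section

namespace Summit.AnomalousDissipation.AnomalousDissipation.Theorems.SawtoothPulseCascade.ApproxResponse

open Set MeasureTheory UnitAddTorus
open scoped ContDiff InnerProductSpace
open Literature.Analysis Literature.Analysis.FunctionSpaces Literature.Analysis.FluidPDE
open Literature.Analysis.FluidPDE.SawtoothCascade
open Literature.Analysis.FluidPDE.SawtoothCascade.CascadeParams
open Summit.AnomalousDissipation.AnomalousDissipation.Theorems.SawtoothPulseCascade.K2Classical

/-! ## §1 Box arithmetic for the Lipschitz envelope -/

/-- `(N_j/δ_j)² = 16 (4ρN²)^j` at the box point. -/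
theorem box_N_div_δ_sq (γ : ℝ) (ρN j : ℕ) :
    (((⟨γ, 1 / 4, 2, 1, ρN⟩ : CascadeParams).N j : ℝ) / (⟨γ, 1 / 4, 2, 1, ρN⟩ : CascadeParams).δ j) ^ 2 =
      16 * (4 * (ρN : ℝ) ^ 2) ^ j := by
  rw [box_N_div_δ, mul_pow, ← pow_mul, show (4 * (ρN : ℝ) ^ 2) = (2 * ρN) ^ 2 by ring, ← pow_mul,
    mul_comm 2 j]
  norm_num

/-- **Geometric bound of the Lipschitz phase envelope at the box point.**  With `G ≥ 0`, `M = max G (4ρN²)`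
(`ρN ≥ 1`), `ν, γ ≥ 0`: the right-hand side of `response_lip_envelope_of_budget` on slot `k` is at most
`32 (48π√(2π) + 12√π) γ ν (k/2 + 1) M^{k/2+1}`. -/
theorem box_lip_sum_le (γ : ℝ) (hγ : 0 ≤ γ) {ρN : ℕ} (hρ : 1 ≤ ρN) {ν G : ℝ} (hν : 0 ≤ ν) (hG : 0 ≤ G) (k : ℕ) :
    ∑ l ∈ Finset.range k, G ^ (k / 2 + 1 - l / 2) *
        ((48 * Real.pi * Real.sqrt (2 * Real.pi) + 12 * Real.sqrt Real.pi) * ν * γ *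
          ((((⟨γ, 1 / 4, 2, 1, ρN⟩ : CascadeParams).N (l / 2) : ℝ) / (⟨γ, 1 / 4, 2, 1, ρN⟩ : CascadeParams).δ (l / 2)) ^ 2)) +
      24 * Real.pi * Real.sqrt (2 * Real.pi) * ν * γ *
        ((((⟨γ, 1 / 4, 2, 1, ρN⟩ : CascadeParams).N (k / 2) : ℝ) / (⟨γ, 1 / 4, 2, 1, ρN⟩ : CascadeParams).δ (k / 2)) ^ 2) ≤
      32 * (48 * Real.pi * Real.sqrt (2 * Real.pi) + 12 * Real.sqrt Real.pi) * γ * ν * ((k / 2 : ℕ) + 1) *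
        (max G (4 * (ρN : ℝ) ^ 2)) ^ (k / 2 + 1) := by
  set M : ℝ := max G (4 * (ρN : ℝ) ^ 2) with hM
  set C₁ : ℝ := 48 * Real.pi * Real.sqrt (2 * Real.pi) + 12 * Real.sqrt Real.pi with hC₁
  have hρ' : (1 : ℝ) ≤ ρN := by exact_mod_cast hρ
  have h4ρ : (4 : ℝ) ≤ 4 * (ρN : ℝ) ^ 2 := by nlinarith
  have hM1 : 1 ≤ M := le_max_of_le_right (by linarith)
  have hM0 : 0 ≤ M := le_trans zero_le_one hM1
  have hGM : G ≤ M := le_max_left _ _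
  have hqM : 4 * (ρN : ℝ) ^ 2 ≤ M := le_max_right _ _
  have hsπ : 0 ≤ Real.sqrt Real.pi := Real.sqrt_nonneg _
  have hs2π : 0 ≤ Real.sqrt (2 * Real.pi) := Real.sqrt_nonneg _
  have hπ := Real.pi_pos.le
  have hC₁0 : 0 ≤ C₁ := by rw [hC₁]; positivity
  have hC₂C₁ : 24 * Real.pi * Real.sqrt (2 * Real.pi) ≤ C₁ := by
    rw [hC₁]; nlinarith [mul_nonneg hπ hs2π]
  -- each summand ≤ 16 C₁ ν γ M^{k/2+1}
  have hterm : ∀ l ∈ Finset.range k, G ^ (k / 2 + 1 - l / 2) *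
      (C₁ * ν * γ * ((((⟨γ, 1 / 4, 2, 1, ρN⟩ : CascadeParams).N (l / 2) : ℝ) /
        (⟨γ, 1 / 4, 2, 1, ρN⟩ : CascadeParams).δ (l / 2)) ^ 2)) ≤ 16 * C₁ * ν * γ * M ^ (k / 2 + 1) := by
    intro l hl
    have hl' : l < k := Finset.mem_range.1 hl
    have hexp : k / 2 + 1 - l / 2 + l / 2 = k / 2 + 1 := by omega
    rw [box_N_div_δ_sq]
    calc G ^ (k / 2 + 1 - l / 2) * (C₁ * ν * γ * (16 * (4 * (ρN : ℝ) ^ 2) ^ (l / 2)))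
        = 16 * C₁ * ν * γ * (G ^ (k / 2 + 1 - l / 2) * (4 * (ρN : ℝ) ^ 2) ^ (l / 2)) := by ring
      _ ≤ 16 * C₁ * ν * γ * (M ^ (k / 2 + 1 - l / 2) * M ^ (l / 2)) := by
          refine mul_le_mul_of_nonneg_left ?_ (by positivity)
          exact mul_le_mul (pow_le_pow_left₀ hG hGM _) (pow_le_pow_left₀ (by positivity) hqM _)
            (by positivity) (pow_nonneg hM0 _)
      _ = 16 * C₁ * ν * γ * M ^ (k / 2 + 1) := by rw [← pow_add, hexp]
  have hsum : ∑ l ∈ Finset.range k, G ^ (k / 2 + 1 - l / 2) *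
      (C₁ * ν * γ * ((((⟨γ, 1 / 4, 2, 1, ρN⟩ : CascadeParams).N (l / 2) : ℝ) /
        (⟨γ, 1 / 4, 2, 1, ρN⟩ : CascadeParams).δ (l / 2)) ^ 2)) ≤ k * (16 * C₁ * ν * γ * M ^ (k / 2 + 1)) := by
    have h := Finset.sum_le_sum hterm
    rwa [Finset.sum_const, Finset.card_range, nsmul_eq_mul] at h
  have hlast : 24 * Real.pi * Real.sqrt (2 * Real.pi) * ν * γ *
      ((((⟨γ, 1 / 4, 2, 1, ρN⟩ : CascadeParams).N (k / 2) : ℝ) / (⟨γ, 1 / 4, 2, 1, ρN⟩ : CascadeParams).δ (k / 2)) ^ 2) ≤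
      16 * C₁ * ν * γ * M ^ (k / 2 + 1) := by
    rw [box_N_div_δ_sq]
    have hp : (4 * (ρN : ℝ) ^ 2) ^ (k / 2) ≤ M ^ (k / 2 + 1) :=
      (pow_le_pow_left₀ (by positivity) hqM _).trans (pow_le_pow_right₀ hM1 (Nat.le_succ _))
    calc 24 * Real.pi * Real.sqrt (2 * Real.pi) * ν * γ * (16 * (4 * (ρN : ℝ) ^ 2) ^ (k / 2))
        = 16 * (24 * Real.pi * Real.sqrt (2 * Real.pi)) * ν * γ * (4 * (ρN : ℝ) ^ 2) ^ (k / 2) := by ring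
      _ ≤ 16 * C₁ * ν * γ * (4 * (ρN : ℝ) ^ 2) ^ (k / 2) := by gcongr
      _ ≤ 16 * C₁ * ν * γ * M ^ (k / 2 + 1) := mul_le_mul_of_nonneg_left hp (by positivity)
  have hk2 : (k : ℝ) + 1 ≤ 2 * (((k / 2 : ℕ) : ℝ) + 1) := by
    have : k + 1 ≤ 2 * (k / 2 + 1) := by omega
    exact_mod_cast this
  have hX : 0 ≤ 16 * C₁ * ν * γ * M ^ (k / 2 + 1) := by positivity
  calc _ ≤ k * (16 * C₁ * ν * γ * M ^ (k / 2 + 1)) + 16 * C₁ * ν * γ * M ^ (k / 2 + 1) := add_le_add hsum hlast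
    _ = ((k : ℝ) + 1) * (16 * C₁ * ν * γ * M ^ (k / 2 + 1)) := by ring
    _ ≤ 2 * (((k / 2 : ℕ) : ℝ) + 1) * (16 * C₁ * ν * γ * M ^ (k / 2 + 1)) := by nlinarith
    _ = 32 * C₁ * γ * ν * (((k / 2 : ℕ) : ℝ) + 1) * M ^ (k / 2 + 1) := by ring

/-- At the box point, `4ρN² < (γ² − 3)²` (`4ρN² ≤ 196 < 484 ≤ (γ²−3)²`). -/
theorem box_four_mul_sq_lt {γ : ℝ} (hγ : γ ∈ Icc (5 : ℝ) 8) {ρN : ℕ} (hρN : ρN ∈ Finset.Icc 2 7) :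
    4 * (ρN : ℝ) ^ 2 < (γ ^ 2 - 3) ^ 2 := by
  obtain ⟨-, hρ7⟩ := Finset.mem_Icc.1 hρN
  have hρ7' : (ρN : ℝ) ≤ 7 := by exact_mod_cast hρ7
  have hρ0 : (0 : ℝ) ≤ ρN := Nat.cast_nonneg _
  have h22 : 22 ≤ γ ^ 2 - 3 := by nlinarith [hγ.1]
  nlinarith

/-- A partial derivative of the zero field vanishes. -/
theorem partialDeriv_zero_fun (i : Fin 2) (x : UnitAddTorus (Fin 2)) :
    Torus.partialDeriv i (fun _ : UnitAddTorus (Fin 2) => (0 : EuclideanSpace ℝ (Fin 2))) x = 0 := by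
  simp [Torus.partialDeriv, Torus.lineDeriv]

/-! ## §2 The Lipschitz envelope on the box -/

/-- **The continuous geometric Lipschitz envelope of the forced linearised response** (S2 of the line
`linear-response-lip`, explicit-hypothesis form, conditional on the per-phase Lipschitz cap at the box point).  See the
module docstring. -/
theorem responseLipEnvelope {γ : ℝ} (hγ : γ ∈ Icc (5 : ℝ) 8) {ρN : ℕ} (hρN : ρN ∈ Finset.Icc 2 7) {G : ℝ}
    (hG0 : 0 ≤ G) (hGlt : G < (γ ^ 2 - 3) ^ 2)
    (hLip : K2LipschitzGrowthClassical ⟨γ, 1 / 4, 2, 1, ρN⟩ G) :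
    ∃ M₁ K : ℝ, 0 ≤ M₁ ∧ M₁ < (γ ^ 2 - 3) ^ 2 ∧ 0 ≤ K ∧
      ∀ A : ℕ, ∃ ν₀ : ℝ, 0 < ν₀ ∧ ∀ ν ∈ Ioc 0 ν₀, ∀ T' : ℝ,
        DriftFree.horizon (γ ^ 2 - 3) ν A < T' → T' < 1 →
        ∀ (L : ℝ → UnitAddTorus (Fin 2) → EuclideanSpace ℝ (Fin 2)) (q : ℝ → UnitAddTorus (Fin 2) → ℝ),
          Torus.IsSmoothSpaceTimeOn (Icc 0 T') L → Torus.IsSmoothSpaceTimeOn (Icc 0 T') q →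
          (∀ t ∈ Icc 0 T', Torus.IsDivFree (L t)) → L 0 = 0 →
          (∀ t ∈ Icc 0 T', ∀ x, Torus.timeDerivWithin (Icc 0 T') L t x +
            Torus.convect ((⟨γ, 1 / 4, 2, 1, ρN⟩ : CascadeParams).field t) (L t) x +
            Torus.convect (L t) ((⟨γ, 1 / 4, 2, 1, ρN⟩ : CascadeParams).field t) x =
              ν • Torus.laplacian (L t) x - Torus.gradient (q t) x +
                ν • Torus.laplacian ((⟨γ, 1 / 4, 2, 1, ρN⟩ : CascadeParams).field t) x) →
          ∃ Λ : ℝ → ℝ, ContinuousOn Λ (Icc 0 (DriftFree.horizon (γ ^ 2 - 3) ν A)) ∧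
            (∀ t ∈ Icc 0 (DriftFree.horizon (γ ^ 2 - 3) ν A), ∀ x : UnitAddTorus (Fin 2),
              ‖Torus.fderiv (L t) x‖ ≤ Λ t) ∧
            ∀ j : ℕ, ∀ t ∈ Icc 0 (DriftFree.horizon (γ ^ 2 - 3) ν A),
              t ∈ Icc (CascadeParams.tStart j) (CascadeParams.tStart (j + 1)) →
              Λ t ≤ K * ν * ((j : ℝ) + 1) * M₁ ^ (j + 1) := by
  set P : CascadeParams := ⟨γ, 1 / 4, 2, 1, ρN⟩ with hP
  obtain ⟨hρ2, hρ7⟩ := Finset.mem_Icc.1 hρN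
  have hρ1 : 1 ≤ ρN := le_trans (by norm_num) hρ2
  have hγ0 : 0 ≤ γ := le_trans (by norm_num) hγ.1
  set M : ℝ := max G (4 * (ρN : ℝ) ^ 2) with hM
  set C₁ : ℝ := 48 * Real.pi * Real.sqrt (2 * Real.pi) + 12 * Real.sqrt Real.pi with hC₁
  set K : ℝ := 64 * C₁ * γ with hK
  have hM1 : 1 ≤ M := le_max_of_le_right (by
    have : (2 : ℝ) ≤ ρN := by exact_mod_cast hρ2
    nlinarith)
  have hM0 : 0 ≤ M := zero_le_one.trans hM1
  have hMlt : M < (γ ^ 2 - 3) ^ 2 := max_lt hGlt (box_four_mul_sq_lt hγ hρN)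
  have hC₁0 : 0 ≤ C₁ := by rw [hC₁]; positivity
  have hK0 : 0 ≤ K := by rw [hK]; positivity
  refine ⟨M, K, hM0, hMlt, hK0, fun A => ?_⟩
  obtain ⟨ν₁, hν₁, hLipν⟩ := hLip
  obtain ⟨νb, hνb, hbud⟩ := budget_threshold hγ hρN A
  refine ⟨min ν₁ νb, lt_min hν₁ hνb, fun ν hν T' hT hT'1 L q hL hq hLdiv hL0 hlin => ?_⟩
  have hν0 : 0 < ν := hν.1
  have hν₁' : ν ∈ Ioc 0 ν₁ := ⟨hν.1, hν.2.trans (min_le_left _ _)⟩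
  have hνb' : ν ∈ Ioc 0 νb := ⟨hν.1, hν.2.trans (min_le_right _ _)⟩
  -- the horizon phase
  set JT : ℕ := Jrate (γ ^ 2 - 3) ν + A with hJT
  have hT_eq : DriftFree.horizon (γ ^ 2 - 3) ν A = tStart JT := rfl
  have hT0 : 0 ≤ DriftFree.horizon (γ ^ 2 - 3) ν A := CascadeParams.tStart_nonneg _
  have hT'0 : 0 < T' := hT0.trans_lt hT
  -- the continuous envelope on `[0, T']`
  obtain ⟨Λ, hΛc, hΛ, -, hΛle⟩ := exists_lipEnvelope hT'0 hL
  have hsub : Icc 0 (DriftFree.horizon (γ ^ 2 - 3) ν A) ⊆ Icc 0 T' := Icc_subset_Icc le_rfl hT.le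
  refine ⟨Λ, hΛc.mono hsub, fun t ht x => hΛ t (hsub ht) x, fun j t ht htj => ?_⟩
  -- pointwise bound on all partial derivatives at time `t`
  have hB0 : 0 ≤ 32 * C₁ * γ * ν * ((j : ℝ) + 1) * M ^ (j + 1) := by positivity
  have hpt : ∀ (i : Fin 2) (x : UnitAddTorus (Fin 2)),
      ‖Torus.partialDeriv i (L t) x‖ ≤ 32 * C₁ * γ * ν * ((j : ℝ) + 1) * M ^ (j + 1) := by
    intro i x
    rw [hT_eq] at ht hT
    by_cases ht0 : t = 0
    · subst ht0
      have hL0' : L 0 = fun _ => (0 : EuclideanSpace ℝ (Fin 2)) := hL0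
      rw [hL0', partialDeriv_zero_fun, norm_zero]
      exact hB0
    have htpos : 0 < t := lt_of_le_of_ne ht.1 (Ne.symm ht0)
    have hJT1 : 1 ≤ JT := by
      by_contra h
      have h0 : JT = 0 := by omega
      have : tStart JT = 0 := by rw [h0]; rfl
      linarith [ht.2]
    have hK2JT : CascadeParams.tInject (2 * JT / 2) (2 * JT % 2 == 0) = tStart JT := slotStart_even JT
    obtain ⟨k, hk, htk, hk0⟩ := exists_slot ht.1 (by omega : 0 < 2 * JT) (by rw [hK2JT]; exact ht.2)
    have hJT' : JT - 1 + 1 = JT := by omega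
    have hbud' : ∀ j' ≤ JT - 1, 16 * Real.pi ^ 2 * ν * ((P.N j' : ℕ) : ℝ) ^ 2 * tHalf j' ≤ P.δ j' ^ 2 :=
      fun j' hj' => hbud ν hνb' j' (by omega)
    have hJTT : tStart (JT - 1 + 1) ≤ T' := by rw [hJT']; exact hT.le
    have hk' : k < 2 * (JT - 1 + 1) := by rw [hJT']; exact hk
    have hL0' : L 0 = fun _ => 0 := hL0
    have henv := response_lip_envelope_of_budget P (by norm_num [hP]) (by norm_num [hP]) hγ0
      (fun j => box_N_ne_zero γ (by omega) j) hν0 hG0 (hLipν ν hν₁') hbud' hJTT hT'1 hL hq hLdiv hL0' hlin hk' htk x i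
    have h2 := box_lip_sum_le γ hγ0 hρ1 hν0.le hG0 k
    have hkj : k / 2 ≤ j := by
      rcases hk0 with h0 | hlt
      · simp [h0]
      · have h1 : tStart (k / 2) < tStart (j + 1) := hlt.trans_le htj.2
        have h2 := tStart_strictMono.lt_iff_lt.1 h1
        omega
    have hKν : 0 ≤ 32 * C₁ * γ * ν := by positivity
    calc ‖Torus.partialDeriv i (L t) x‖ ≤ _ := henv
      _ ≤ 32 * (48 * Real.pi * Real.sqrt (2 * Real.pi) + 12 * Real.sqrt Real.pi) * γ * ν * (((k / 2 : ℕ) : ℝ) + 1) *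
            (max G (4 * (ρN : ℝ) ^ 2)) ^ (k / 2 + 1) := h2
      _ = (32 * C₁ * γ * ν) * ((((k / 2 : ℕ) : ℝ) + 1) * M ^ (k / 2 + 1)) := by rw [hC₁, hM]; ring
      _ ≤ (32 * C₁ * γ * ν) * (((j : ℝ) + 1) * M ^ (j + 1)) := mul_le_mul_of_nonneg_left (envelope_mono hM1 hkj) hKν
      _ = 32 * C₁ * γ * ν * ((j : ℝ) + 1) * M ^ (j + 1) := by ring
  calc Λ t ≤ (Fintype.card (Fin 2) : ℝ) * (32 * C₁ * γ * ν * ((j : ℝ) + 1) * M ^ (j + 1)) :=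
        hΛle t (hsub ht) _ hB0 hpt
    _ = K * ν * ((j : ℝ) + 1) * M ^ (j + 1) := by rw [hK]; simp; ring

end Summit.AnomalousDissipation.AnomalousDissipation.Theorems.SawtoothPulseCascade.ApproxResponse

end
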